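import Literature.Probability.Process.MartingaleFiniteVariation
import Literature.Probability.Process.SimpleIntegralMartingale
import Mathlib.Analysis.SpecialFunctions.ExpDeriv
import HarnessLib

/-!
# Exponential tilting of a martingale problem (Feynman–Kac weights, exponential change of measure)

Topic `Probability/Process`; theorems only. Let `𝓕` be a raw filtration of `ℝ≥0` on a probability
space, `X` a real process with continuous paths, progressively and jointly measurable, and let
`φ, ψ, V : ℝ → ℝ` be bounded continuous functions such that

  `N^φ_t = φ(X_t) - φ(X_0) - ∫₀ᵗ ψ(X_s) ds`

is an `𝓕`-martingale — one instance of a **martingale problem** for `X` (`ψ = Lφ` for the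
generator `L`; Karatzas–Shreve (1988), Ch. 5 §4.B; Stroock–Varadhan). With the multiplicative
functional `E_t = exp(-∫₀ᵗ V(X_s) ds)` we prove, WITHOUT any stochastic integration (only the
integration-by-parts lemma `martingale_mul_timeIntegral_sub` of `MartingaleFiniteVariation` for a
martingale against a process of finite variation, and pathwise calculus):

* `martingale_mul_expWeight_sub_timeIntegral` — **the Feynman–Kac / tilting identity**:
  `φ(X_t) E_t - ∫₀ᵗ E_s (ψ - V φ)(X_s) ds` is an `𝓕`-martingale;
* `martingale_mul_expWeight`, `martingale_expDensity` — if `ψ = V φ` (i.e. `V = Lφ/φ` for a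
  positive `φ = g`), then `g(X_t) E_t` and the **exponential density**
  `N_t = (g(X_t)/g(X_0)) exp(-∫₀ᵗ (Lg/g)(X_s) ds)` are martingales (Palmowski–Rolski (2002),
  Lemma 3.1 / Thm 4.2: the exponential change of measure for Markov processes; here in the
  martingale-problem form, for a raw filtration);
* `martingale_expDensity_mul_sub_timeIntegral`, `setIntegral_mul_expDensity_eq` — **the tilted
  martingale problem**: if moreover `(gf)(X) - ∫ ψ₂(X)` is a martingale and `ψ₂ - V g f = g ψ'`
  (`ψ' = L^g f = Lf + a (g'/g) f'`, the Doob `h`-transform of the generator), then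
  `N_t (f(X_t) - ∫₀ᵗ ψ'(X_s) ds)` is a `P`-martingale, i.e. `f(X_t) - ∫₀ᵗ ψ'(X_s) ds` is a
  martingale on `[0, T]` under the tilted probability `N_T · P` (set-integral form).

This is the device by which a drift is added to or removed from a one-dimensional diffusion
described by its martingale problem (Girsanov's theorem for `h`-transforms, with the stochastic
integral `∫ (g'/g)(X) dM` traded for `log g(X_t) - log g(X_0)` by Itô's formula — here never
written). Everything is proved; no named fact is introduced.

## References

* Z. Palmowski, T. Rolski, *A technique for exponential change of measure for Markov processes*,
  Bernoulli 8 (2002), 767–785: Lemma 3.1, Theorem 4.2. [PalmowskiRolski2002]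
* I. Karatzas, S. Shreve, *Brownian Motion and Stochastic Calculus* (1988), Ch. 5 §4.B
  (martingale problem), Ch. 3 §5 (Girsanov). [KaratzasShreve1988]
* D. Revuz, M. Yor, *Continuous Martingales and Brownian Motion* (1999), Ch. VIII §3
  (`h`-processes, exponential martingales).
-/

noncomputable section

open MeasureTheory ProbabilityTheory Filter Set Function
open scoped NNReal ENNReal Topology

namespace Literature.Probability.Process

open Literature.Analysis.FunctionSpaces

/-! ### Pathwise calculus: the multiplicative functional `exp(-∫₀ᵗ v)` -/

section Pathwise

/-- `u ↦ exp(-∫₀ᵘ v)` has derivative `-v(u) exp(-∫₀ᵘ v)` for continuous `v`. [folklore] -/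
theorem hasDerivAt_exp_neg_integral {v : ℝ → ℝ} (hv : Continuous v) (u : ℝ) :
    HasDerivAt (fun u ↦ Real.exp (-∫ r in (0 : ℝ)..u, v r))
      (-v u * Real.exp (-∫ r in (0 : ℝ)..u, v r)) u := by
  have h1 : HasDerivAt (fun u ↦ ∫ r in (0 : ℝ)..u, v r) (v u) u :=
    (hv.integral_hasStrictDerivAt 0 u).hasDerivAt
  have h2 : HasDerivAt (fun u ↦ -∫ r in (0 : ℝ)..u, v r) (-v u) u := h1.neg
  exact h2.exp.congr_deriv (by ring)

/-- **`∫₀ᵗ v(u) exp(-∫₀ᵘ v) du = 1 - exp(-∫₀ᵗ v)`** for continuous `v` (fundamental theorem of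
calculus for the multiplicative functional). [folklore] -/
theorem integral_mul_exp_neg_integral_eq (v : ℝ → ℝ) (hv : Continuous v) (t : ℝ) :
    ∫ u in (0 : ℝ)..t, v u * Real.exp (-∫ r in (0 : ℝ)..u, v r) =
      1 - Real.exp (-∫ r in (0 : ℝ)..t, v r) := by
  have hcont : Continuous fun u ↦ v u * Real.exp (-∫ r in (0 : ℝ)..u, v r) :=
    hv.mul (continuous_iff_continuousAt.2 fun u ↦ (hasDerivAt_exp_neg_integral hv u).continuousAt)
  have hF : ∀ u, HasDerivAt (fun u ↦ -Real.exp (-∫ r in (0 : ℝ)..u, v r))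
      (v u * Real.exp (-∫ r in (0 : ℝ)..u, v r)) u := fun u ↦ by
    have h : HasDerivAt (fun u ↦ -Real.exp (-∫ r in (0 : ℝ)..u, v r))
        (-(-v u * Real.exp (-∫ r in (0 : ℝ)..u, v r))) u := (hasDerivAt_exp_neg_integral hv u).neg
    exact h.congr_deriv (by ring)
  rw [intervalIntegral.integral_eq_sub_of_hasDerivAt (fun u _ ↦ hF u) (hcont.intervalIntegrable 0 t)]
  simp only [intervalIntegral.integral_same, neg_zero, Real.exp_zero]
  ring

/-- **Product rule**: `(∫₀ᵗ a) exp(-∫₀ᵗ v) = ∫₀ᵗ (a(u) - (∫₀ᵘ a) v(u)) exp(-∫₀ᵘ v) du` for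
continuous `a, v`. [folklore] -/
theorem integral_mul_exp_neg_integral (a v : ℝ → ℝ) (ha : Continuous a) (hv : Continuous v) (t : ℝ) :
    (∫ u in (0 : ℝ)..t, a u) * Real.exp (-∫ u in (0 : ℝ)..t, v u) =
      ∫ u in (0 : ℝ)..t, (a u - (∫ r in (0 : ℝ)..u, a r) * v u) * Real.exp (-∫ r in (0 : ℝ)..u, v r) := by
  have hA : ∀ u, HasDerivAt (fun u ↦ ∫ r in (0 : ℝ)..u, a r) (a u) u := fun u ↦
    (ha.integral_hasStrictDerivAt 0 u).hasDerivAt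
  have hE := hasDerivAt_exp_neg_integral hv
  have hF : ∀ u, HasDerivAt (fun u ↦ (∫ r in (0 : ℝ)..u, a r) * Real.exp (-∫ r in (0 : ℝ)..u, v r))
      ((a u - (∫ r in (0 : ℝ)..u, a r) * v u) * Real.exp (-∫ r in (0 : ℝ)..u, v r)) u := fun u ↦
    ((hA u).mul (hE u)).congr_deriv (by ring)
  have hAc : Continuous fun u ↦ ∫ r in (0 : ℝ)..u, a r :=
    continuous_iff_continuousAt.2 fun u ↦ (hA u).continuousAt
  have hEc : Continuous fun u ↦ Real.exp (-∫ r in (0 : ℝ)..u, v r) :=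
    continuous_iff_continuousAt.2 fun u ↦ (hE u).continuousAt
  have hcont : Continuous fun u ↦
      (a u - (∫ r in (0 : ℝ)..u, a r) * v u) * Real.exp (-∫ r in (0 : ℝ)..u, v r) :=
    ((ha.sub (hAc.mul hv)).mul hEc)
  rw [intervalIntegral.integral_eq_sub_of_hasDerivAt (fun u _ ↦ hF u) (hcont.intervalIntegrable 0 t)]
  simp

end Pathwise

/-! ### Time integrals: joint measurability, paths -/

section TimeIntegral

variable {Ω : Type*} {mΩ : MeasurableSpace Ω}

/-- The time integral of a jointly measurable process is jointly measurable in `(t, ω)`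
(a parametric Lebesgue integral). [folklore] -/
theorem measurable_uncurry_timeIntegral {g : ℝ≥0 → Ω → ℝ} (hg : Measurable (uncurry g)) :
    Measurable (uncurry (timeIntegral g)) := by
  -- integrand `(p, s) ↦ 𝟙_{(0, p.1]}(s) g (s⁺) p.2`
  have hG : Measurable (fun q : (ℝ≥0 × Ω) × ℝ ↦ g q.2.toNNReal q.1.2) :=
    hg.comp ((measurable_real_toNNReal.comp measurable_snd).prodMk (measurable_snd.comp measurable_fst))
  have hS : MeasurableSet {q : (ℝ≥0 × Ω) × ℝ | q.2 ∈ Ioc (0 : ℝ) q.1.1} := by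
    have h1 : Measurable (fun q : (ℝ≥0 × Ω) × ℝ ↦ q.2) := measurable_snd
    have h2 : Measurable (fun q : (ℝ≥0 × Ω) × ℝ ↦ ((q.1.1 : ℝ≥0) : ℝ)) :=
      measurable_coe_nnreal_real.comp (measurable_fst.comp measurable_fst)
    exact (measurableSet_lt measurable_const h1).inter (measurableSet_le h1 h2)
  have hf : StronglyMeasurable (uncurry fun (p : ℝ≥0 × Ω) (s : ℝ) ↦
      {q : (ℝ≥0 × Ω) × ℝ | q.2 ∈ Ioc (0 : ℝ) q.1.1}.indicator (fun q ↦ g q.2.toNNReal q.1.2) (p, s)) :=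
    (hG.indicator hS).stronglyMeasurable
  have hint := StronglyMeasurable.integral_prod_right (ν := (volume : Measure ℝ)) hf
  have heq : uncurry (timeIntegral g) = fun p : ℝ≥0 × Ω ↦
      ∫ s, {q : (ℝ≥0 × Ω) × ℝ | q.2 ∈ Ioc (0 : ℝ) q.1.1}.indicator (fun q ↦ g q.2.toNNReal q.1.2) (p, s) := by
    funext p
    rw [uncurry, timeIntegral, intervalIntegral.integral_of_le (NNReal.coe_nonneg _),
      ← integral_indicator measurableSet_Ioc]
    rfl
  rw [heq]
  exact hint.measurable

/-- A jointly measurable process composed with a measurable function is jointly measurable.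
[folklore] -/
theorem measurable_uncurry_comp {X : ℝ≥0 → Ω → ℝ} (hX : Measurable (uncurry X)) {f : ℝ → ℝ}
    (hf : Measurable f) : Measurable (uncurry fun t ω ↦ f (X t ω)) :=
  hf.comp hX

/-- The path `u ↦ f (X u⁺ ω)` of a process with continuous paths through a continuous `f` is
continuous on `ℝ`. [folklore] -/
theorem continuous_path_comp_toNNReal {X : ℝ≥0 → Ω → ℝ} {ω : Ω} (hX : Continuous (X · ω))
    {f : ℝ → ℝ} (hf : Continuous f) : Continuous fun u : ℝ ↦ f (X u.toNNReal ω) :=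
  hf.comp (hX.comp continuous_real_toNNReal)

/-- For a process `g` with continuous paths `u ↦ g u⁺ ω` on `ℝ`, the time integral up to `t` is
the interval integral (unfolding). [folklore] -/
theorem timeIntegral_apply_eq_intervalIntegral (g : ℝ≥0 → Ω → ℝ) (t : ℝ≥0) (ω : Ω) :
    timeIntegral g t ω = ∫ s in (0 : ℝ)..t, g s.toNNReal ω := rfl

/-- The time integral read at a real time `u ≥ 0` through `u⁺`. [folklore] -/
theorem timeIntegral_toNNReal (g : ℝ≥0 → Ω → ℝ) {u : ℝ} (hu : 0 ≤ u) (ω : Ω) :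
    timeIntegral g u.toNNReal ω = ∫ s in (0 : ℝ)..u, g s.toNNReal ω := by
  rw [timeIntegral_apply_eq_intervalIntegral, Real.coe_toNNReal _ hu]

end TimeIntegral

/-! ### Progressive measurability: three elementary closure properties -/

section Progressive

variable {Ω : Type*} {mΩ : MeasurableSpace Ω} {𝓕 : Filtration ℝ≥0 mΩ} {X : ℝ≥0 → Ω → ℝ}

-- A continuous function of a progressive real process is progressive:
-- `IsStronglyProgressive.continuous_comp` (`ProgressiveDensity`, in the import closure).

/-- The initial value, as a constant-in-time process, is progressive. [folklore] -/
theorem _root_.MeasureTheory.IsStronglyProgressive.initial (hX : IsStronglyProgressive 𝓕 X) :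
    IsStronglyProgressive 𝓕 fun (_ : ℝ≥0) ω ↦ X 0 ω := by
  intro i
  have h0 : StronglyMeasurable[𝓕 0] (X 0) := hX.stronglyAdapted 0
  have h0i : StronglyMeasurable[𝓕 i] (X 0) := h0.mono (𝓕.mono bot_le)
  exact h0i.comp_measurable (@measurable_snd (Set.Iic i) Ω _ (𝓕 i))

/-- A progressive process frozen at a deterministic time `T`, `t ↦ U (t ∧ T)`, is progressive.
[folklore] -/
theorem _root_.MeasureTheory.IsStronglyProgressive.min_const {U : ℝ≥0 → Ω → ℝ} (hU : IsStronglyProgressive 𝓕 U) (T : ℝ≥0) :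
    IsStronglyProgressive 𝓕 fun t ω ↦ U (min t T) ω := by
  refine hU.comp (t := fun t _ ↦ min t T) (fun i ↦ ?_) fun t _ ↦ min_le_left t T
  exact (continuous_subtype_val.min continuous_const).stronglyMeasurable.comp_measurable
    (@measurable_fst (Set.Iic i) Ω _ (𝓕 i))

/-- A progressive process killed after a deterministic time `T`, `t ↦ 𝟙_{t ≤ T} U t`, is
progressive. [folklore] -/
theorem _root_.MeasureTheory.IsStronglyProgressive.indicator_le_const {U : ℝ≥0 → Ω → ℝ} (hU : IsStronglyProgressive 𝓕 U)
    (T : ℝ≥0) : IsStronglyProgressive 𝓕 fun t ω ↦ if t ≤ T then U t ω else 0 := by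
  intro i
  have hset : MeasurableSet[Subtype.instMeasurableSpace.prod (𝓕 i)]
      {p : Set.Iic i × Ω | (p.1 : ℝ≥0) ≤ T} :=
    (measurableSet_Iic (a := T)).preimage
      (measurable_subtype_coe.comp (@measurable_fst (Set.Iic i) Ω _ (𝓕 i)))
  have h := (hU i).indicator hset
  have heq : (fun p : Set.Iic i × Ω ↦ if ((p.1 : ℝ≥0)) ≤ T then U p.1 p.2 else 0) =
      {p : Set.Iic i × Ω | (p.1 : ℝ≥0) ≤ T}.indicator fun p ↦ U p.1 p.2 := by
    funext p
    simp only [Set.indicator_apply, Set.mem_setOf_eq]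
  show StronglyMeasurable[Subtype.instMeasurableSpace.prod (𝓕 i)]
    (fun p : Set.Iic i × Ω ↦ if ((p.1 : ℝ≥0)) ≤ T then U p.1 p.2 else 0)
  rw [heq]
  exact h

end Progressive

/-! ### The tilting theorem -/

section Tilting

variable {Ω : Type*} {mΩ : MeasurableSpace Ω} {P : Measure Ω} [IsProbabilityMeasure P]
  {𝓕 : Filtration ℝ≥0 mΩ} {X : ℝ≥0 → Ω → ℝ}

/-- A time integral of a bounded integrand is bounded by `C t`. [folklore] -/
theorem abs_timeIntegral_le {g : ℝ≥0 → Ω → ℝ} {C : ℝ} (hgb : ∀ t ω, |g t ω| ≤ C) (t : ℝ≥0) (ω : Ω) :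
    |timeIntegral g t ω| ≤ C * t := by
  unfold timeIntegral
  have := intervalIntegral.norm_integral_le_of_norm_le_const (a := (0 : ℝ)) (b := (t : ℝ))
    (f := fun r : ℝ ↦ g r.toNNReal ω) (C := C) fun r _ ↦ by rw [Real.norm_eq_abs]; exact hgb _ _
  rw [Real.norm_eq_abs, sub_zero, abs_of_nonneg t.coe_nonneg] at this
  exact this

/-- The exponential weight `exp(-∫₀ᵗ V(X_s) ds)` is positive and at most `exp(C t)` when
`|V| ≤ C`. [folklore] -/
theorem exp_neg_timeIntegral_le {V : ℝ → ℝ} {CV : ℝ} (hVb : ∀ x, |V x| ≤ CV) (t : ℝ≥0) (ω : Ω) :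
    Real.exp (-timeIntegral (fun s ω ↦ V (X s ω)) t ω) ≤ Real.exp (CV * t) := by
  refine Real.exp_le_exp.2 ?_
  have h := abs_timeIntegral_le (g := fun s ω ↦ V (X s ω)) (fun s ω ↦ hVb _) t ω
  have := neg_abs_le (timeIntegral (fun s ω ↦ V (X s ω)) t ω)
  linarith

/-- **The pathwise identity behind the tilting theorem.** With `N_t = φ(X_t) - φ(X_0) - ∫₀ᵗ ψ(X)`,
`E_t = exp(-∫₀ᵗ V(X))` and `e_t = -V(X_t) E_t = Ė_t`:
`φ(X_t) E_t - ∫₀ᵗ E (ψ - Vφ)(X) = φ(X_0) + N_t + (N_t ∫₀ᵗ e - ∫₀ᵗ N_s e_s ds)` (product rule for the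
finite-variation factors, for each path). [folklore] -/
theorem tilt_pathwise {ω : Ω} (hXc : Continuous (X · ω)) {φ ψ V : ℝ → ℝ} (hφ : Continuous φ)
    (hψ : Continuous ψ) (hV : Continuous V) (r : ℝ≥0) :
    φ (X r ω) * Real.exp (-timeIntegral (fun s ω ↦ V (X s ω)) r ω) -
        timeIntegral (fun s ω ↦ Real.exp (-timeIntegral (fun r ω ↦ V (X r ω)) s ω) *
          (ψ (X s ω) - V (X s ω) * φ (X s ω))) r ω =
      φ (X 0 ω) + (φ (X r ω) - φ (X 0 ω) - timeIntegral (fun s ω ↦ ψ (X s ω)) r ω) +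
        ((φ (X r ω) - φ (X 0 ω) - timeIntegral (fun s ω ↦ ψ (X s ω)) r ω) *
            timeIntegral (fun s ω ↦ -V (X s ω) * Real.exp (-timeIntegral (fun r ω ↦ V (X r ω)) s ω)) r ω -
          timeIntegral (fun s ω ↦ (φ (X s ω) - φ (X 0 ω) - timeIntegral (fun r ω ↦ ψ (X r ω)) s ω) *
            (-V (X s ω) * Real.exp (-timeIntegral (fun r ω ↦ V (X r ω)) s ω))) r ω) := by
  -- the real-variable path functions
  set xφ : ℝ → ℝ := fun u ↦ φ (X u.toNNReal ω) with hxφ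
  set xψ : ℝ → ℝ := fun u ↦ ψ (X u.toNNReal ω) with hxψ
  set xV : ℝ → ℝ := fun u ↦ V (X u.toNNReal ω) with hxV
  have cφ : Continuous xφ := continuous_path_comp_toNNReal hXc hφ
  have cψ : Continuous xψ := continuous_path_comp_toNNReal hXc hψ
  have cV : Continuous xV := continuous_path_comp_toNNReal hXc hV
  set A : ℝ → ℝ := fun u ↦ ∫ s in (0 : ℝ)..u, xψ s with hA
  set Er : ℝ → ℝ := fun u ↦ Real.exp (-∫ s in (0 : ℝ)..u, xV s) with hEr
  have cA : Continuous A := continuous_iff_continuousAt.2 fun u ↦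
    ((cψ.integral_hasStrictDerivAt 0 u).hasDerivAt).continuousAt
  have cEr : Continuous Er := continuous_iff_continuousAt.2 fun u ↦
    (hasDerivAt_exp_neg_integral cV u).continuousAt
  set φ₀ : ℝ := φ (X 0 ω) with hφ₀
  -- reading the time integrals as integrals of the path functions
  have hAt : ∀ {u : ℝ}, 0 ≤ u → timeIntegral (fun s ω ↦ ψ (X s ω)) u.toNNReal ω = A u :=
    fun hu ↦ timeIntegral_toNNReal _ hu ω
  have hEt : ∀ {u : ℝ}, 0 ≤ u →
      Real.exp (-timeIntegral (fun r ω ↦ V (X r ω)) u.toNNReal ω) = Er u := fun hu ↦ by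
    rw [timeIntegral_toNNReal _ hu ω]
  have hr0 : (0 : ℝ) ≤ r := r.coe_nonneg
  have hmem : ∀ u ∈ uIcc (0 : ℝ) r, 0 ≤ u := fun u hu ↦ by
    rw [uIcc_of_le hr0] at hu; exact hu.1
  have hAr : timeIntegral (fun s ω ↦ ψ (X s ω)) r ω = A r := rfl
  have hEr_r : Real.exp (-timeIntegral (fun s ω ↦ V (X s ω)) r ω) = Er r := rfl
  have hI1 : timeIntegral (fun s ω ↦ Real.exp (-timeIntegral (fun r ω ↦ V (X r ω)) s ω) *
      (ψ (X s ω) - V (X s ω) * φ (X s ω))) r ω = ∫ u in (0 : ℝ)..r, Er u * (xψ u - xV u * xφ u) := by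
    rw [timeIntegral_apply_eq_intervalIntegral]
    refine intervalIntegral.integral_congr fun u hu ↦ ?_
    simp only [hEt (hmem u hu)]
    rfl
  have hJ : timeIntegral (fun s ω ↦ -V (X s ω) * Real.exp (-timeIntegral (fun r ω ↦ V (X r ω)) s ω)) r ω =
      ∫ u in (0 : ℝ)..r, -(xV u * Er u) := by
    rw [timeIntegral_apply_eq_intervalIntegral]
    refine intervalIntegral.integral_congr fun u hu ↦ ?_
    simp only [hEt (hmem u hu), neg_mul]
    rfl
  have hI2 : timeIntegral (fun s ω ↦ (φ (X s ω) - φ (X 0 ω) - timeIntegral (fun r ω ↦ ψ (X r ω)) s ω) *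
      (-V (X s ω) * Real.exp (-timeIntegral (fun r ω ↦ V (X r ω)) s ω))) r ω =
      ∫ u in (0 : ℝ)..r, (xφ u - φ₀ - A u) * (-(xV u * Er u)) := by
    rw [timeIntegral_apply_eq_intervalIntegral]
    refine intervalIntegral.integral_congr fun u hu ↦ ?_
    simp only [hEt (hmem u hu), hAt (hmem u hu), neg_mul]
    rfl
  rw [hI1, hJ, hI2, hAr, hEr_r]
  -- the two calculus identities
  have hL1 : ∫ u in (0 : ℝ)..r, xV u * Er u = 1 - Er r := integral_mul_exp_neg_integral_eq xV cV r
  have hL2 : A r * Er r = ∫ u in (0 : ℝ)..r, (xψ u - A u * xV u) * Er u :=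
    integral_mul_exp_neg_integral xψ xV cψ cV r
  -- integrability of everything in sight
  have i1 : IntervalIntegrable (fun u ↦ Er u * (xψ u - xV u * xφ u)) volume 0 r :=
    (cEr.mul (cψ.sub (cV.mul cφ))).intervalIntegrable 0 r
  have i2 : IntervalIntegrable (fun u ↦ (xφ u - φ₀ - A u) * (-(xV u * Er u))) volume 0 r :=
    (((cφ.sub continuous_const).sub cA).mul (cV.mul cEr).neg).intervalIntegrable 0 r
  have i3 : IntervalIntegrable (fun u ↦ xV u * Er u) volume 0 r := (cV.mul cEr).intervalIntegrable 0 r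
  have i4 : IntervalIntegrable (fun u ↦ (xψ u - A u * xV u) * Er u) volume 0 r :=
    ((cψ.sub (cA.mul cV)).mul cEr).intervalIntegrable 0 r
  -- `J = Er r - 1`
  have hJ' : ∫ u in (0 : ℝ)..r, -(xV u * Er u) = Er r - 1 := by
    rw [intervalIntegral.integral_neg, hL1]; ring
  -- `I2 - I1 = φ₀ (1 - Er r) - A r Er r`
  have hI : (∫ u in (0 : ℝ)..r, (xφ u - φ₀ - A u) * (-(xV u * Er u))) -
      (∫ u in (0 : ℝ)..r, Er u * (xψ u - xV u * xφ u)) = φ₀ * (1 - Er r) - A r * Er r := by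
    rw [← intervalIntegral.integral_sub i2 i1]
    have heq : ∀ u, (xφ u - φ₀ - A u) * (-(xV u * Er u)) - Er u * (xψ u - xV u * xφ u) =
        φ₀ * (xV u * Er u) - (xψ u - A u * xV u) * Er u := fun u ↦ by ring
    simp_rw [heq]
    rw [intervalIntegral.integral_sub (i3.const_mul φ₀) i4, intervalIntegral.integral_const_mul, hL1, ← hL2]
  linear_combination hI - (φ (X r ω) - φ₀ - A r) * hJ'

/-- **Exponential tilting of a martingale problem (Feynman–Kac identity).** Let `X` be a
progressive real process with continuous paths and `φ, ψ, V` bounded continuous functions such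
that `φ(X_t) - φ(X_0) - ∫₀ᵗ ψ(X_s) ds` is an `𝓕`-martingale. Then, with
`E_t = exp(-∫₀ᵗ V(X_s) ds)`,

  `φ(X_t) E_t - ∫₀ᵗ E_s (ψ(X_s) - V(X_s) φ(X_s)) ds`

is an `𝓕`-martingale. (Pathwise, `φ(X_t) E_t = φ(X_0) + N_t E_t - ∫₀ᵗ N_s dE_s + ∫₀ᵗ E_s (ψ - Vφ)(X_s) ds`
with `N` the given martingale, and `N_t E_t - ∫₀ᵗ N dE` is a martingale by
`martingale_mul_timeIntegral_sub`.) Palmowski–Rolski (2002), Lemma 3.1 (the process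
`h(X_t) exp(-∫₀ᵗ (Ah/h)(X_s) ds)` for `h` in the domain of the generator); Karatzas–Shreve (1988),
Ch. 5 §4.B. [cite: PalmowskiRolski2002, Lemma 3.1] -/
theorem martingale_mul_expWeight_sub_timeIntegral
    (hX : IsStronglyProgressive 𝓕 X) (hXc : ∀ ω, Continuous (X · ω))
    {φ ψ V : ℝ → ℝ} {Cφ Cψ CV : ℝ} (hφ : Continuous φ) (hψ : Continuous ψ) (hV : Continuous V)
    (hφb : ∀ x, |φ x| ≤ Cφ) (hψb : ∀ x, |ψ x| ≤ Cψ) (hVb : ∀ x, |V x| ≤ CV)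
    (hM : Martingale (fun t ω ↦ φ (X t ω) - φ (X 0 ω) - timeIntegral (fun s ω ↦ ψ (X s ω)) t ω) 𝓕 P) :
    Martingale (fun t ω ↦ φ (X t ω) * Real.exp (-timeIntegral (fun s ω ↦ V (X s ω)) t ω) -
      timeIntegral (fun s ω ↦ Real.exp (-timeIntegral (fun r ω ↦ V (X r ω)) s ω) *
        (ψ (X s ω) - V (X s ω) * φ (X s ω))) t ω) 𝓕 P := by
  -- notation
  set N : ℝ≥0 → Ω → ℝ := fun t ω ↦ φ (X t ω) - φ (X 0 ω) - timeIntegral (fun s ω ↦ ψ (X s ω)) t ω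
    with hNdef
  set E : ℝ≥0 → Ω → ℝ := fun t ω ↦ Real.exp (-timeIntegral (fun s ω ↦ V (X s ω)) t ω) with hEdef
  set e : ℝ≥0 → Ω → ℝ := fun t ω ↦ -V (X t ω) * E t ω with hedef
  set Y : ℝ≥0 → Ω → ℝ := fun t ω ↦ φ (X t ω) * E t ω -
      timeIntegral (fun s ω ↦ E s ω * (ψ (X s ω) - V (X s ω) * φ (X s ω))) t ω with hYdef
  have hCφ : 0 ≤ Cφ := (abs_nonneg _).trans (hφb 0)
  have hCψ : 0 ≤ Cψ := (abs_nonneg _).trans (hψb 0)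
  have hCV : 0 ≤ CV := (abs_nonneg _).trans (hVb 0)
  -- progressivity of the pieces
  have hφX : IsStronglyProgressive 𝓕 fun t ω ↦ φ (X t ω) := IsStronglyProgressive.continuous_comp hX hφ
  have hψX : IsStronglyProgressive 𝓕 fun t ω ↦ ψ (X t ω) := IsStronglyProgressive.continuous_comp hX hψ
  have hVX : IsStronglyProgressive 𝓕 fun t ω ↦ V (X t ω) := IsStronglyProgressive.continuous_comp hX hV
  have hφ0 : IsStronglyProgressive 𝓕 fun (_ : ℝ≥0) ω ↦ φ (X 0 ω) :=
    IsStronglyProgressive.continuous_comp hX.initial hφ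
  have hE : IsStronglyProgressive 𝓕 E :=
    IsStronglyProgressive.continuous_comp (isStronglyProgressive_timeIntegral hVX)
      (Real.continuous_exp.comp continuous_neg)
  have he : IsStronglyProgressive 𝓕 e := (hVX.neg).mul hE
  have hN : IsStronglyProgressive 𝓕 N := (hφX.sub hφ0).sub (isStronglyProgressive_timeIntegral hψX)
  have hY : IsStronglyProgressive 𝓕 Y :=
    (hφX.mul hE).sub (isStronglyProgressive_timeIntegral (hE.mul (hψX.sub (hVX.mul hφX))))
  -- bounds
  have hEpos : ∀ t ω, 0 < E t ω := fun t ω ↦ Real.exp_pos _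
  have hEle : ∀ t ω, E t ω ≤ Real.exp (CV * t) := fun t ω ↦ exp_neg_timeIntegral_le hVb t ω
  have hNb : ∀ t ω, |N t ω| ≤ 2 * Cφ + Cψ * t := fun t ω ↦ by
    have h1 := hφb (X t ω)
    have h2 := hφb (X 0 ω)
    have h3 := abs_timeIntegral_le (g := fun s ω ↦ ψ (X s ω)) (fun s ω ↦ hψb _) t ω
    calc |N t ω| ≤ |φ (X t ω) - φ (X 0 ω)| + |timeIntegral (fun s ω ↦ ψ (X s ω)) t ω| := abs_sub _ _
      _ ≤ (|φ (X t ω)| + |φ (X 0 ω)|) + Cψ * t := add_le_add (abs_sub _ _) h3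
      _ ≤ 2 * Cφ + Cψ * t := by linarith
  refine ⟨hY.stronglyAdapted, fun s t hst ↦ ?_⟩
  -- horizon `T = t`: truncations
  set T : ℝ≥0 := t with hTdef
  set NT : ℝ≥0 → Ω → ℝ := fun r ω ↦ N (min r T) ω with hNTdef
  set hT : ℝ≥0 → Ω → ℝ := fun r ω ↦ if r ≤ T then e r ω else 0 with hhTdef
  have hNTmart : Martingale NT 𝓕 P := martingale_min_const hM T
  have hNTprog : IsStronglyProgressive 𝓕 NT := hN.min_const T
  have hNTb : ∀ r ω, |NT r ω| ≤ 2 * Cφ + Cψ * T := fun r ω ↦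
    (hNb _ _).trans (by gcongr; exact min_le_right r T)
  have hhTprog : IsStronglyProgressive 𝓕 hT := he.indicator_le_const T
  have hhTb : ∀ r ω, |hT r ω| ≤ CV * Real.exp (CV * T) := fun r ω ↦ by
    by_cases hr : r ≤ T
    · simp only [hhTdef, if_pos hr, hedef]
      rw [abs_mul, abs_neg, abs_of_pos (hEpos r ω)]
      exact mul_le_mul (hVb _) ((hEle r ω).trans (Real.exp_le_exp.2 (by gcongr)))
        (hEpos r ω).le hCV
    · simp only [hhTdef, if_neg hr, abs_zero]
      positivity
  have hPair := martingale_mul_timeIntegral_sub hNTmart hNTprog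
    (IsStronglyProgressive.measurable_uncurry hNTprog) hNTb hhTprog
    (IsStronglyProgressive.measurable_uncurry hhTprog) hhTb
  -- the comparison martingale `G = φ(X_0) + N + pairing`
  have h0 : Martingale (fun (_ : ℝ≥0) ω ↦ φ (X 0 ω)) 𝓕 P := by
    have hm : StronglyMeasurable[𝓕 0] fun ω ↦ φ (X 0 ω) :=
      hφ.comp_stronglyMeasurable (hX.stronglyAdapted 0)
    refine martingale_const_fun 𝓕 P (f := fun ω ↦ φ (X 0 ω)) hm ?_
    exact Integrable.mono' (integrable_const Cφ) ((hm.mono (𝓕.le 0)).aestronglyMeasurable)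
      (Eventually.of_forall fun ω ↦ by rw [Real.norm_eq_abs]; exact hφb _)
  have hG : Martingale (fun r ω ↦ φ (X 0 ω) + N r ω +
      (NT r ω * timeIntegral hT r ω - timeIntegral (fun s ω ↦ NT s ω * hT s ω) r ω)) 𝓕 P :=
    (h0.add hM).add hPair
  -- the pathwise identity `Y r = G r` for `r ≤ T`
  have hYG : ∀ r ≤ T, Y r = fun ω ↦ φ (X 0 ω) + N r ω +
      (NT r ω * timeIntegral hT r ω - timeIntegral (fun s ω ↦ NT s ω * hT s ω) r ω) := by
    intro r hr
    funext ω
    have hNT : NT r ω = N r ω := by simp only [hNTdef, min_eq_left hr]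
    have hmem : ∀ u ∈ uIcc (0 : ℝ) r, u.toNNReal ≤ T := fun u hu ↦ by
      rw [uIcc_of_le r.coe_nonneg] at hu
      exact (Real.toNNReal_le_iff_le_coe.2 hu.2).trans hr
    have hT1 : timeIntegral hT r ω = timeIntegral e r ω := by
      simp only [timeIntegral_apply_eq_intervalIntegral]
      refine intervalIntegral.integral_congr fun u hu ↦ ?_
      simp only [hhTdef, if_pos (hmem u hu)]
    have hT2 : timeIntegral (fun s ω ↦ NT s ω * hT s ω) r ω = timeIntegral (fun s ω ↦ N s ω * e s ω) r ω := by
      simp only [timeIntegral_apply_eq_intervalIntegral]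
      refine intervalIntegral.integral_congr fun u hu ↦ ?_
      simp only [hhTdef, hNTdef, if_pos (hmem u hu), min_eq_left (hmem u hu)]
    rw [hNT, hT1, hT2]
    exact tilt_pathwise (hXc ω) hφ hψ hV r
  -- conclusion
  have h1 : P[Y t|𝓕 s] =ᵐ[P] Y s := by
    rw [hYG t le_rfl, hYG s hst]
    exact hG.condExp_ae_eq hst
  exact h1

/-! ### Locally bounded versions of the integration-by-parts lemma -/

omit [IsProbabilityMeasure P] in
/-- A process which agrees up to every horizon `T` with some martingale is a martingale.
[folklore] -/
theorem martingale_of_forall_horizon {Y : ℝ≥0 → Ω → ℝ}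
    (h : ∀ T : ℝ≥0, ∃ G : ℝ≥0 → Ω → ℝ, Martingale G 𝓕 P ∧ ∀ r ≤ T, Y r = G r) :
    Martingale Y 𝓕 P := by
  refine ⟨fun t ↦ ?_, fun s t hst ↦ ?_⟩
  · obtain ⟨G, hG, hYG⟩ := h t
    rw [hYG t le_rfl]
    exact hG.stronglyAdapted t
  · obtain ⟨G, hG, hYG⟩ := h t
    rw [hYG t le_rfl, hYG s hst]
    exact hG.condExp_ae_eq hst

/-- **`D_t H_t - ∫₀ᵗ D_s h_s ds` is a martingale** for a progressive martingale `D` and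
`H = ∫ h`, `h` progressive, both bounded on every bounded time interval (locally bounded
version of `martingale_mul_timeIntegral_sub`, by freezing `D` and killing `h` after the horizon).
[cite: KaratzasShreve1988, Ch. 5 §4.B Prop. 4.6] -/
theorem martingale_mul_timeIntegral_sub_of_locally_bdd {D h : ℝ≥0 → Ω → ℝ} (hD : Martingale D 𝓕 P)
    (hDprog : IsStronglyProgressive 𝓕 D) (hh : IsStronglyProgressive 𝓕 h)
    (hDb : ∀ T : ℝ≥0, ∃ C : ℝ, ∀ r ≤ T, ∀ ω, |D r ω| ≤ C)
    (hhb : ∀ T : ℝ≥0, ∃ C : ℝ, ∀ r ≤ T, ∀ ω, |h r ω| ≤ C) :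
    Martingale (fun t ω ↦ D t ω * timeIntegral h t ω - timeIntegral (fun s ω ↦ D s ω * h s ω) t ω) 𝓕 P := by
  refine martingale_of_forall_horizon fun T ↦ ?_
  obtain ⟨CD, hCD⟩ := hDb T
  obtain ⟨Ch, hCh⟩ := hhb T
  set DT : ℝ≥0 → Ω → ℝ := fun r ω ↦ D (min r T) ω with hDTdef
  set hT : ℝ≥0 → Ω → ℝ := fun r ω ↦ if r ≤ T then h r ω else 0 with hhTdef
  have hDTmart : Martingale DT 𝓕 P := martingale_min_const hD T
  have hDTprog : IsStronglyProgressive 𝓕 DT := hDprog.min_const T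
  have hDTb : ∀ r ω, |DT r ω| ≤ CD := fun r ω ↦ hCD _ (min_le_right r T) ω
  have hhTprog : IsStronglyProgressive 𝓕 hT := hh.indicator_le_const T
  have hhTb : ∀ r ω, |hT r ω| ≤ Ch := fun r ω ↦ by
    by_cases hr : r ≤ T
    · simp only [hhTdef, if_pos hr]; exact hCh r hr ω
    · simp only [hhTdef, if_neg hr, abs_zero]; exact (abs_nonneg _).trans (hCh 0 bot_le ω)
  refine ⟨_, martingale_mul_timeIntegral_sub hDTmart hDTprog
    (IsStronglyProgressive.measurable_uncurry hDTprog) hDTb hhTprog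
    (IsStronglyProgressive.measurable_uncurry hhTprog) hhTb, fun r hr ↦ ?_⟩
  funext ω
  have hmem : ∀ u ∈ uIcc (0 : ℝ) r, u.toNNReal ≤ T := fun u hu ↦ by
    rw [uIcc_of_le r.coe_nonneg] at hu
    exact (Real.toNNReal_le_iff_le_coe.2 hu.2).trans hr
  have h1 : DT r ω = D r ω := by simp only [hDTdef, min_eq_left hr]
  have h2 : timeIntegral hT r ω = timeIntegral h r ω := by
    simp only [timeIntegral_apply_eq_intervalIntegral]
    refine intervalIntegral.integral_congr fun u hu ↦ ?_
    simp only [hhTdef, if_pos (hmem u hu)]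
  have h3 : timeIntegral (fun s ω ↦ DT s ω * hT s ω) r ω = timeIntegral (fun s ω ↦ D s ω * h s ω) r ω := by
    simp only [timeIntegral_apply_eq_intervalIntegral]
    refine intervalIntegral.integral_congr fun u hu ↦ ?_
    simp only [hhTdef, hDTdef, if_pos (hmem u hu), min_eq_left (hmem u hu)]
  rw [h1, h2, h3]

/-- Adding an integrable `𝓕₀`-measurable random constant to a martingale gives a martingale.
[folklore] -/
theorem _root_.MeasureTheory.Martingale.const_add {M : ℝ≥0 → Ω → ℝ} (hM : Martingale M 𝓕 P) {ξ : Ω → ℝ}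
    (hξ : StronglyMeasurable[𝓕 0] ξ) (hξi : Integrable ξ P) :
    Martingale (fun t ω ↦ ξ ω + M t ω) 𝓕 P :=
  (martingale_const_fun 𝓕 P hξ hξi).add hM

/-- Multiplying a martingale vanishing at time `0` by a bounded `𝓕₀`-measurable factor gives a
martingale (`martingale_mul_of_eq_zero` at `a = 0`). [folklore] -/
theorem _root_.MeasureTheory.Martingale.bdd_mul_of_apply_zero {M : ℝ≥0 → Ω → ℝ} (hM : Martingale M 𝓕 P)
    (hM0 : M 0 = 0) {ξ : Ω → ℝ} (hξ : StronglyMeasurable[𝓕 0] ξ) (hξb : ∃ C, ∀ ω, |ξ ω| ≤ C) :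
    Martingale (fun t ω ↦ ξ ω * M t ω) 𝓕 P :=
  martingale_mul_of_eq_zero hM (fun r hr ↦ by rw [le_antisymm hr bot_le]; exact hM0) hξ hξb

/-! ### The exponential density `N_t = (g(X_t)/g(X_0)) exp(-∫₀ᵗ (Lg/g)(X))` -/

/-- **`g(X_t) exp(-∫₀ᵗ V(X_s) ds)` is a martingale when `ψ = V g`**, i.e. when
`g(X_t) - g(X_0) - ∫₀ᵗ (V g)(X_s) ds` is a martingale (`V = Lg/g`: Palmowski–Rolski (2002),
Lemma 3.1). [cite: PalmowskiRolski2002, Lemma 3.1] -/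
theorem martingale_mul_expWeight (hX : IsStronglyProgressive 𝓕 X) (hXc : ∀ ω, Continuous (X · ω))
    {g V : ℝ → ℝ} {Cg CV : ℝ} (hg : Continuous g) (hV : Continuous V)
    (hgb : ∀ x, |g x| ≤ Cg) (hVb : ∀ x, |V x| ≤ CV)
    (hM : Martingale (fun t ω ↦ g (X t ω) - g (X 0 ω) - timeIntegral (fun s ω ↦ V (X s ω) * g (X s ω)) t ω) 𝓕 P) :
    Martingale (fun t ω ↦ g (X t ω) * Real.exp (-timeIntegral (fun s ω ↦ V (X s ω)) t ω)) 𝓕 P := by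
  have hCg : 0 ≤ Cg := (abs_nonneg _).trans (hgb 0)
  have hCV : 0 ≤ CV := (abs_nonneg _).trans (hVb 0)
  have h := martingale_mul_expWeight_sub_timeIntegral hX hXc hg (ψ := fun x ↦ V x * g x)
    (show Continuous (fun x ↦ V x * g x) from hV.mul hg) hV hgb
    (Cψ := CV * Cg) (fun x ↦ by rw [abs_mul]; exact mul_le_mul (hVb x) (hgb x) (abs_nonneg _) hCV)
    hVb hM
  have heq : (fun t ω ↦ g (X t ω) * Real.exp (-timeIntegral (fun s ω ↦ V (X s ω)) t ω) -
      timeIntegral (fun s ω ↦ Real.exp (-timeIntegral (fun r ω ↦ V (X r ω)) s ω) *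
        (V (X s ω) * g (X s ω) - V (X s ω) * g (X s ω))) t ω) =
      fun t ω ↦ g (X t ω) * Real.exp (-timeIntegral (fun s ω ↦ V (X s ω)) t ω) := by
    funext t ω
    simp [timeIntegral]
  rwa [heq] at h

/-- **The exponential density is a martingale**: for `g` continuous with `0 < c ≤ g ≤ C` and
`V` bounded continuous such that `g(X_t) - g(X_0) - ∫₀ᵗ (Vg)(X_s) ds` is a martingale, the process
`N_t = (g(X_t)/g(X_0)) exp(-∫₀ᵗ V(X_s) ds)` is a martingale with `N_0 = 1`. Palmowski–Rolski
(2002), Lemma 3.1 / Thm 4.2 (`E^h(t) = (h(X_t)/h(X_0)) exp(-∫₀ᵗ (Ah/h)(X_s) ds)` is a mean-one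
martingale). [cite: PalmowskiRolski2002, Thm 4.2] -/
theorem martingale_expDensity (hX : IsStronglyProgressive 𝓕 X) (hXc : ∀ ω, Continuous (X · ω))
    {g V : ℝ → ℝ} {c Cg CV : ℝ} (hg : Continuous g) (hV : Continuous V) (hc : 0 < c)
    (hgc : ∀ x, c ≤ g x) (hgb : ∀ x, |g x| ≤ Cg) (hVb : ∀ x, |V x| ≤ CV)
    (hM : Martingale (fun t ω ↦ g (X t ω) - g (X 0 ω) - timeIntegral (fun s ω ↦ V (X s ω) * g (X s ω)) t ω) 𝓕 P) :
    Martingale (fun t ω ↦ g (X t ω) / g (X 0 ω) * Real.exp (-timeIntegral (fun s ω ↦ V (X s ω)) t ω)) 𝓕 P := by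
  have hD := martingale_mul_expWeight hX hXc hg hV hgb hVb hM
  -- `D - g(X_0)` vanishes at `0`
  have hg0m : StronglyMeasurable[𝓕 0] fun ω ↦ g (X 0 ω) := hg.comp_stronglyMeasurable (hX.stronglyAdapted 0)
  have hg0i : Integrable (fun ω ↦ g (X 0 ω)) P :=
    Integrable.mono' (integrable_const Cg) ((hg0m.mono (𝓕.le 0)).aestronglyMeasurable)
      (Eventually.of_forall fun ω ↦ by rw [Real.norm_eq_abs]; exact hgb _)
  have hD' : Martingale (fun t ω ↦ -g (X 0 ω) +
      g (X t ω) * Real.exp (-timeIntegral (fun s ω ↦ V (X s ω)) t ω)) 𝓕 P :=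
    hD.const_add hg0m.neg hg0i.neg
  have hD'0 : (fun ω ↦ -g (X 0 ω) + g (X 0 ω) * Real.exp (-timeIntegral (fun s ω ↦ V (X s ω)) 0 ω)) = 0 := by
    funext ω; simp
  have hξ : StronglyMeasurable[𝓕 0] fun ω ↦ (g (X 0 ω))⁻¹ := by
    refine (continuousOn_inv₀.comp_continuous hg ?_).comp_stronglyMeasurable (hX.stronglyAdapted 0)
    exact fun x ↦ (hc.trans_le (hgc x)).ne'
  have hξb : ∃ C, ∀ ω, |(g (X 0 ω))⁻¹| ≤ C := ⟨c⁻¹, fun ω ↦ by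
    rw [abs_inv, abs_of_pos (hc.trans_le (hgc _))]
    exact inv_anti₀ hc (hgc _)⟩
  have hN := (hD'.bdd_mul_of_apply_zero hD'0 hξ hξb).const_add
    (ξ := fun _ ↦ (1 : ℝ)) stronglyMeasurable_const (integrable_const 1)
  have heq : (fun t ω ↦ (1 : ℝ) + (g (X 0 ω))⁻¹ * (-g (X 0 ω) +
      g (X t ω) * Real.exp (-timeIntegral (fun s ω ↦ V (X s ω)) t ω))) =
      fun t ω ↦ g (X t ω) / g (X 0 ω) * Real.exp (-timeIntegral (fun s ω ↦ V (X s ω)) t ω) := by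
    funext t ω
    have hg0 : g (X 0 ω) ≠ 0 := (hc.trans_le (hgc _)).ne'
    field_simp
    ring
  rwa [heq] at hN

/-- The exponential density starts at `1`. [folklore] -/
theorem expDensity_apply_zero {g V : ℝ → ℝ} {c : ℝ} (hc : 0 < c) (hgc : ∀ x, c ≤ g x) (ω : Ω) :
    g (X 0 ω) / g (X 0 ω) * Real.exp (-timeIntegral (fun s ω ↦ V (X s ω)) 0 ω) = 1 := by
  have hg0 : g (X 0 ω) ≠ 0 := (hc.trans_le (hgc _)).ne'
  simp [div_self hg0]

/-- The exponential density is positive. [folklore] -/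
theorem expDensity_pos {g V : ℝ → ℝ} {c : ℝ} (hc : 0 < c) (hgc : ∀ x, c ≤ g x) (t : ℝ≥0) (ω : Ω) :
    0 < g (X t ω) / g (X 0 ω) * Real.exp (-timeIntegral (fun s ω ↦ V (X s ω)) t ω) :=
  mul_pos (div_pos (hc.trans_le (hgc _)) (hc.trans_le (hgc _))) (Real.exp_pos _)

/-- The exponential density is bounded on bounded time intervals: `N_t ≤ (C/c) e^{C_V t}`.
[folklore] -/
theorem expDensity_le {g V : ℝ → ℝ} {c Cg CV : ℝ} (hc : 0 < c) (hgc : ∀ x, c ≤ g x)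
    (hgb : ∀ x, |g x| ≤ Cg) (hVb : ∀ x, |V x| ≤ CV) (t : ℝ≥0) (ω : Ω) :
    g (X t ω) / g (X 0 ω) * Real.exp (-timeIntegral (fun s ω ↦ V (X s ω)) t ω) ≤
      Cg / c * Real.exp (CV * t) := by
  have hgt : g (X t ω) ≤ Cg := (le_abs_self _).trans (hgb _)
  have hCg : 0 ≤ Cg := (hc.le.trans (hgc (X t ω))).trans hgt
  refine mul_le_mul ?_ (exp_neg_timeIntegral_le hVb t ω) (Real.exp_pos _).le (div_nonneg hCg hc.le)
  exact div_le_div₀ hCg hgt hc (hgc _)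

/-- **The exponential density has mean one**: `E[N_T] = 1`. [cite: PalmowskiRolski2002, Thm 4.2] -/
theorem integral_expDensity (hX : IsStronglyProgressive 𝓕 X) (hXc : ∀ ω, Continuous (X · ω))
    {g V : ℝ → ℝ} {c Cg CV : ℝ} (hg : Continuous g) (hV : Continuous V) (hc : 0 < c)
    (hgc : ∀ x, c ≤ g x) (hgb : ∀ x, |g x| ≤ Cg) (hVb : ∀ x, |V x| ≤ CV)
    (hM : Martingale (fun t ω ↦ g (X t ω) - g (X 0 ω) - timeIntegral (fun s ω ↦ V (X s ω) * g (X s ω)) t ω) 𝓕 P)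
    (T : ℝ≥0) :
    ∫ ω, g (X T ω) / g (X 0 ω) * Real.exp (-timeIntegral (fun s ω ↦ V (X s ω)) T ω) ∂P = 1 := by
  have hN := martingale_expDensity hX hXc hg hV hc hgc hgb hVb hM
  have h := hN.setIntegral_eq (show (0 : ℝ≥0) ≤ T from bot_le) (MeasurableSet.univ)
  simp only [Measure.restrict_univ] at h
  rw [← h]
  have heq : (fun ω ↦ g (X 0 ω) / g (X 0 ω) * Real.exp (-timeIntegral (fun s ω ↦ V (X s ω)) 0 ω)) =
      fun _ ↦ (1 : ℝ) := funext fun ω ↦ expDensity_apply_zero hc hgc ω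
  rw [heq]
  simp

/-! ### The tilted martingale problem (Doob `h`-transform of the generator) -/

/-- **The tilted martingale problem.** Let `N_t = (g(X_t)/g(X_0)) exp(-∫₀ᵗ V(X))` be the
exponential density of `martingale_expDensity` (`V = Lg/g`), and let `f` be a further test
function: `(gf)(X_t) - (gf)(X_0) - ∫₀ᵗ ψ₂(X_s) ds` is a martingale (`ψ₂ = L(gf)`) with the algebraic
identity `ψ₂ - V g f = g ψ'` (`ψ' = L^g f = (1/g)(L(gf) - f Lg)`, the `h`-transformed generator).
Then `N_t (f(X_t) - ∫₀ᵗ ψ'(X_s) ds)` is a `P`-martingale. Palmowski–Rolski (2002), Thm 4.2 (under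
the tilted measure the process solves the martingale problem for `A^h f = h⁻¹[A(fh) - f Ah]`).
[cite: PalmowskiRolski2002, Thm 4.2] -/
theorem martingale_expDensity_mul_sub_timeIntegral (hX : IsStronglyProgressive 𝓕 X)
    (hXc : ∀ ω, Continuous (X · ω)) {g V f ψ₂ ψ' : ℝ → ℝ} {c Cg CV Cf Cψ₂ Cψ' : ℝ}
    (hg : Continuous g) (hV : Continuous V) (hf : Continuous f) (hψ₂ : Continuous ψ₂) (hψ' : Continuous ψ')
    (hc : 0 < c) (hgc : ∀ x, c ≤ g x) (hgb : ∀ x, |g x| ≤ Cg) (hVb : ∀ x, |V x| ≤ CV)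
    (hfb : ∀ x, |f x| ≤ Cf) (hψ₂b : ∀ x, |ψ₂ x| ≤ Cψ₂) (hψ'b : ∀ x, |ψ' x| ≤ Cψ')
    (hMg : Martingale (fun t ω ↦ g (X t ω) - g (X 0 ω) - timeIntegral (fun s ω ↦ V (X s ω) * g (X s ω)) t ω) 𝓕 P)
    (hMgf : Martingale (fun t ω ↦ g (X t ω) * f (X t ω) - g (X 0 ω) * f (X 0 ω) -
      timeIntegral (fun s ω ↦ ψ₂ (X s ω)) t ω) 𝓕 P)
    (hrel : ∀ x, ψ₂ x - V x * (g x * f x) = g x * ψ' x) :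
    Martingale (fun t ω ↦ (g (X t ω) / g (X 0 ω) * Real.exp (-timeIntegral (fun s ω ↦ V (X s ω)) t ω)) *
      (f (X t ω) - timeIntegral (fun s ω ↦ ψ' (X s ω)) t ω)) 𝓕 P := by
  have hCg : 0 ≤ Cg := (abs_nonneg _).trans (hgb 0)
  have hCf : 0 ≤ Cf := (abs_nonneg _).trans (hfb 0)
  set E : ℝ≥0 → Ω → ℝ := fun t ω ↦ Real.exp (-timeIntegral (fun s ω ↦ V (X s ω)) t ω) with hEdef
  set D : ℝ≥0 → Ω → ℝ := fun t ω ↦ g (X t ω) * E t ω with hDdef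
  -- progressivity
  have hgX : IsStronglyProgressive 𝓕 fun t ω ↦ g (X t ω) := IsStronglyProgressive.continuous_comp hX hg
  have hVX : IsStronglyProgressive 𝓕 fun t ω ↦ V (X t ω) := IsStronglyProgressive.continuous_comp hX hV
  have hψ'X : IsStronglyProgressive 𝓕 fun t ω ↦ ψ' (X t ω) := IsStronglyProgressive.continuous_comp hX hψ'
  have hE : IsStronglyProgressive 𝓕 E :=
    IsStronglyProgressive.continuous_comp (isStronglyProgressive_timeIntegral hVX)
      (Real.continuous_exp.comp continuous_neg)
  have hD : Martingale D 𝓕 P := martingale_mul_expWeight hX hXc hg hV hgb hVb hMg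
  have hDprog : IsStronglyProgressive 𝓕 D := hgX.mul hE
  -- the tilting identity for `gf`
  have hY := martingale_mul_expWeight_sub_timeIntegral hX hXc (φ := fun x ↦ g x * f x) (ψ := ψ₂)
    (show Continuous (fun x ↦ g x * f x) from hg.mul hf) hψ₂ hV (Cφ := Cg * Cf)
    (fun x ↦ by rw [abs_mul]; exact mul_le_mul (hgb x) (hfb x) (abs_nonneg _) hCg) hψ₂b hVb hMgf
  -- the pairing `D ∫ψ'(X) - ∫ D ψ'(X)`
  have hPair := martingale_mul_timeIntegral_sub_of_locally_bdd hD hDprog hψ'X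
    (fun T ↦ ⟨Cg * Real.exp (CV * T), fun r hr ω ↦ by
      simp only [hDdef, hEdef]
      rw [abs_mul, abs_of_pos (Real.exp_pos _)]
      exact mul_le_mul (hgb _) ((exp_neg_timeIntegral_le hVb r ω).trans (Real.exp_le_exp.2 (by
        have hCV : 0 ≤ CV := (abs_nonneg _).trans (hVb 0)
        gcongr))) (Real.exp_pos _).le hCg⟩)
    (fun _ ↦ ⟨Cψ', fun r _ ω ↦ hψ'b _⟩)
  -- their difference is `D (f(X) - ∫ ψ'(X))`
  have hDΦ : Martingale (fun t ω ↦ D t ω * (f (X t ω) - timeIntegral (fun s ω ↦ ψ' (X s ω)) t ω)) 𝓕 P := by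
    have heq : (fun t ω ↦ D t ω * (f (X t ω) - timeIntegral (fun s ω ↦ ψ' (X s ω)) t ω)) =
        fun t ω ↦ ((fun x ↦ g x * f x) (X t ω) * Real.exp (-timeIntegral (fun s ω ↦ V (X s ω)) t ω) -
          timeIntegral (fun s ω ↦ Real.exp (-timeIntegral (fun r ω ↦ V (X r ω)) s ω) *
            (ψ₂ (X s ω) - V (X s ω) * (fun x ↦ g x * f x) (X s ω))) t ω) -
          (D t ω * timeIntegral (fun s ω ↦ ψ' (X s ω)) t ω -
            timeIntegral (fun s ω ↦ D s ω * ψ' (X s ω)) t ω) := by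
      funext t ω
      have hint : timeIntegral (fun s ω ↦ Real.exp (-timeIntegral (fun r ω ↦ V (X r ω)) s ω) *
            (ψ₂ (X s ω) - V (X s ω) * (fun x ↦ g x * f x) (X s ω))) t ω =
          timeIntegral (fun s ω ↦ D s ω * ψ' (X s ω)) t ω := by
        simp only [timeIntegral_apply_eq_intervalIntegral, hDdef, hEdef]
        refine intervalIntegral.integral_congr fun u _ ↦ ?_
        simp only [hrel]
        ring
      rw [hint]
      simp only [hDdef]
      ring
    rw [heq]
    exact hY.sub hPair
  -- divide by `g(X_0)`
  have hg0m : StronglyMeasurable[𝓕 0] fun ω ↦ g (X 0 ω) := hg.comp_stronglyMeasurable (hX.stronglyAdapted 0)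
  have hf0m : StronglyMeasurable[𝓕 0] fun ω ↦ f (X 0 ω) := hf.comp_stronglyMeasurable (hX.stronglyAdapted 0)
  have hgf0m : StronglyMeasurable[𝓕 0] fun ω ↦ g (X 0 ω) * f (X 0 ω) := hg0m.mul hf0m
  have hgf0m' : StronglyMeasurable[𝓕 0] fun ω ↦ -(g (X 0 ω) * f (X 0 ω)) := hgf0m.neg
  have hgf0i : Integrable (fun ω ↦ -(g (X 0 ω) * f (X 0 ω))) P :=
    (Integrable.mono' (integrable_const (Cg * Cf)) ((hgf0m.mono (𝓕.le 0)).aestronglyMeasurable)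
      (Eventually.of_forall fun ω ↦ by
        rw [Real.norm_eq_abs, abs_mul]; exact mul_le_mul (hgb _) (hfb _) (abs_nonneg _) hCg)).neg
  have hM' := hDΦ.const_add hgf0m' hgf0i
  have hM'0 : (fun ω ↦ -(g (X 0 ω) * f (X 0 ω)) +
      D 0 ω * (f (X 0 ω) - timeIntegral (fun s ω ↦ ψ' (X s ω)) 0 ω)) = 0 := by
    funext ω; simp [hDdef, hEdef]
  have hξ : StronglyMeasurable[𝓕 0] fun ω ↦ (g (X 0 ω))⁻¹ := by
    refine (continuousOn_inv₀.comp_continuous hg ?_).comp_stronglyMeasurable (hX.stronglyAdapted 0)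
    exact fun x ↦ (hc.trans_le (hgc x)).ne'
  have hξb : ∃ C, ∀ ω, |(g (X 0 ω))⁻¹| ≤ C := ⟨c⁻¹, fun ω ↦ by
    rw [abs_inv, abs_of_pos (hc.trans_le (hgc _))]
    exact inv_anti₀ hc (hgc _)⟩
  have hf0i : Integrable (fun ω ↦ f (X 0 ω)) P :=
    Integrable.mono' (integrable_const Cf) ((hf0m.mono (𝓕.le 0)).aestronglyMeasurable)
      (Eventually.of_forall fun ω ↦ by rw [Real.norm_eq_abs]; exact hfb _)
  have hN := (hM'.bdd_mul_of_apply_zero hM'0 hξ hξb).const_add hf0m hf0i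
  have heq : (fun t ω ↦ f (X 0 ω) + (g (X 0 ω))⁻¹ * (-(g (X 0 ω) * f (X 0 ω)) +
      D t ω * (f (X t ω) - timeIntegral (fun s ω ↦ ψ' (X s ω)) t ω))) =
      fun t ω ↦ (g (X t ω) / g (X 0 ω) * Real.exp (-timeIntegral (fun s ω ↦ V (X s ω)) t ω)) *
        (f (X t ω) - timeIntegral (fun s ω ↦ ψ' (X s ω)) t ω) := by
    funext t ω
    have hg0 : g (X 0 ω) ≠ 0 := (hc.trans_le (hgc _)).ne'
    simp only [hDdef, hEdef]
    field_simp
    ring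
  rwa [heq] at hN

/-- **The tilted measure is a probability measure**: `Q_T = N_T · P` has total mass `E[N_T] = 1`.
[cite: PalmowskiRolski2002, Thm 4.2] -/
theorem isProbabilityMeasure_withDensity_expDensity (hX : IsStronglyProgressive 𝓕 X)
    (hXc : ∀ ω, Continuous (X · ω)) {g V : ℝ → ℝ} {c Cg CV : ℝ} (hg : Continuous g) (hV : Continuous V)
    (hc : 0 < c) (hgc : ∀ x, c ≤ g x) (hgb : ∀ x, |g x| ≤ Cg) (hVb : ∀ x, |V x| ≤ CV)
    (hM : Martingale (fun t ω ↦ g (X t ω) - g (X 0 ω) - timeIntegral (fun s ω ↦ V (X s ω) * g (X s ω)) t ω) 𝓕 P)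
    (T : ℝ≥0) :
    IsProbabilityMeasure (P.withDensity fun ω ↦
      ENNReal.ofReal (g (X T ω) / g (X 0 ω) * Real.exp (-timeIntegral (fun s ω ↦ V (X s ω)) T ω))) := by
  have hN := martingale_expDensity hX hXc hg hV hc hgc hgb hVb hM
  refine ⟨?_⟩
  rw [withDensity_apply _ MeasurableSet.univ, Measure.restrict_univ,
    ← ofReal_integral_eq_lintegral_ofReal (hN.integrable T)
      (Eventually.of_forall fun ω ↦ (expDensity_pos hc hgc T ω).le),
    integral_expDensity hX hXc hg hV hc hgc hgb hVb hM T, ENNReal.ofReal_one]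

/-- **`P` is absolutely continuous with respect to the tilted measure** (the density is
positive). [folklore] -/
theorem absolutelyContinuous_withDensity_expDensity (hX : IsStronglyProgressive 𝓕 X)
    (hXc : ∀ ω, Continuous (X · ω)) {g V : ℝ → ℝ} {c Cg CV : ℝ} (hg : Continuous g) (hV : Continuous V)
    (hc : 0 < c) (hgc : ∀ x, c ≤ g x) (hgb : ∀ x, |g x| ≤ Cg) (hVb : ∀ x, |V x| ≤ CV)
    (hM : Martingale (fun t ω ↦ g (X t ω) - g (X 0 ω) - timeIntegral (fun s ω ↦ V (X s ω) * g (X s ω)) t ω) 𝓕 P)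
    (T : ℝ≥0) :
    P ≪ P.withDensity fun ω ↦
      ENNReal.ofReal (g (X T ω) / g (X 0 ω) * Real.exp (-timeIntegral (fun s ω ↦ V (X s ω)) T ω)) := by
  have hN := martingale_expDensity hX hXc hg hV hc hgc hgb hVb hM
  refine withDensity_absolutelyContinuous' ?_ (Eventually.of_forall fun ω ↦ ?_)
  · exact ((hN.stronglyMeasurable T).mono (𝓕.le T)).measurable.ennreal_ofReal.aemeasurable
  · exact (ENNReal.ofReal_pos.2 (expDensity_pos hc hgc T ω)).ne'

/-- Swapping the terminal density for the current one against an `𝓕_t`-measurable bounded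
weight: `∫_A N_T Y = ∫_A N_t Y` for `A ∈ 𝓕_s`, `s ≤ t ≤ T`, `Y` bounded `𝓕_t`-measurable
(martingale property of `N`). [folklore] -/
theorem setIntegral_mul_eq_of_martingale {N : ℝ≥0 → Ω → ℝ} (hN : Martingale N 𝓕 P) {s t T : ℝ≥0}
    (hst : s ≤ t) (htT : t ≤ T) {A : Set Ω} (hA : MeasurableSet[𝓕 s] A) {Y : Ω → ℝ}
    (hY : Measurable[𝓕 t] Y) {C : ℝ} (hYb : ∀ ω, |Y ω| ≤ C) :
    ∫ ω in A, N T ω * Y ω ∂P = ∫ ω in A, N t ω * Y ω ∂P := by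
  have hAt : MeasurableSet[𝓕 t] A := 𝓕.mono hst A hA
  have hG : Measurable[𝓕 t] (A.indicator Y) := hY.indicator hAt
  have hGb : ∀ ω, |A.indicator Y ω| ≤ C := fun ω ↦ by
    by_cases hω : ω ∈ A
    · rw [indicator_of_mem hω]; exact hYb ω
    · rw [indicator_of_notMem hω, abs_zero]; exact (abs_nonneg _).trans (hYb ω)
  have h0 := integral_mul_sub_eq_zero_of_martingale hN htT hG hGb
  have hGm : AEStronglyMeasurable (A.indicator Y) P :=
    ((hG.mono (𝓕.le t) le_rfl)).aestronglyMeasurable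
  have hi : ∀ r, Integrable (fun ω ↦ A.indicator Y ω * N r ω) P := fun r ↦
    (hN.integrable r).bdd_mul hGm (Eventually.of_forall fun ω ↦ by
      rw [Real.norm_eq_abs]; exact hGb ω)
  have h1 : ∫ ω, A.indicator Y ω * N T ω ∂P = ∫ ω, A.indicator Y ω * N t ω ∂P := by
    have : ∫ ω, A.indicator Y ω * (N T ω - N t ω) ∂P =
        ∫ ω, A.indicator Y ω * N T ω ∂P - ∫ ω, A.indicator Y ω * N t ω ∂P := by
      rw [← integral_sub (hi T) (hi t)]
      refine integral_congr_ae (Eventually.of_forall fun ω ↦ ?_)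
      ring
    rw [this] at h0
    linarith
  have hAm : MeasurableSet A := 𝓕.le s A hA
  rw [← integral_indicator hAm, ← integral_indicator hAm]
  have e1 : (A.indicator fun ω ↦ N T ω * Y ω) = fun ω ↦ A.indicator Y ω * N T ω := by
    funext ω; by_cases hω : ω ∈ A <;> simp [hω, mul_comm]
  have e2 : (A.indicator fun ω ↦ N t ω * Y ω) = fun ω ↦ A.indicator Y ω * N t ω := by
    funext ω; by_cases hω : ω ∈ A <;> simp [hω, mul_comm]
  rw [e1, e2, h1]

/-- **The tilted martingale problem, set-integral form.** Under the hypotheses of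
`martingale_expDensity_mul_sub_timeIntegral`, for `s ≤ t ≤ T` and `A ∈ 𝓕_s`:
`∫_A N_T Φ_t dP = ∫_A N_T Φ_s dP` with `Φ_r = f(X_r) - ∫₀ʳ ψ'(X)` — i.e. `Φ` is a martingale on
`[0, T]` under the tilted probability `Q_T = N_T · P`. [cite: PalmowskiRolski2002, Thm 4.2] -/
theorem setIntegral_expDensity_mul_eq (hX : IsStronglyProgressive 𝓕 X)
    (hXc : ∀ ω, Continuous (X · ω)) {g V f ψ₂ ψ' : ℝ → ℝ} {c Cg CV Cf Cψ₂ Cψ' : ℝ}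
    (hg : Continuous g) (hV : Continuous V) (hf : Continuous f) (hψ₂ : Continuous ψ₂) (hψ' : Continuous ψ')
    (hc : 0 < c) (hgc : ∀ x, c ≤ g x) (hgb : ∀ x, |g x| ≤ Cg) (hVb : ∀ x, |V x| ≤ CV)
    (hfb : ∀ x, |f x| ≤ Cf) (hψ₂b : ∀ x, |ψ₂ x| ≤ Cψ₂) (hψ'b : ∀ x, |ψ' x| ≤ Cψ')
    (hMg : Martingale (fun t ω ↦ g (X t ω) - g (X 0 ω) - timeIntegral (fun s ω ↦ V (X s ω) * g (X s ω)) t ω) 𝓕 P)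
    (hMgf : Martingale (fun t ω ↦ g (X t ω) * f (X t ω) - g (X 0 ω) * f (X 0 ω) -
      timeIntegral (fun s ω ↦ ψ₂ (X s ω)) t ω) 𝓕 P)
    (hrel : ∀ x, ψ₂ x - V x * (g x * f x) = g x * ψ' x)
    {s t T : ℝ≥0} (hst : s ≤ t) (htT : t ≤ T) {A : Set Ω} (hA : MeasurableSet[𝓕 s] A) :
    ∫ ω in A, (g (X T ω) / g (X 0 ω) * Real.exp (-timeIntegral (fun s ω ↦ V (X s ω)) T ω)) *
        (f (X t ω) - timeIntegral (fun s ω ↦ ψ' (X s ω)) t ω) ∂P =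
      ∫ ω in A, (g (X T ω) / g (X 0 ω) * Real.exp (-timeIntegral (fun s ω ↦ V (X s ω)) T ω)) *
        (f (X s ω) - timeIntegral (fun s ω ↦ ψ' (X s ω)) s ω) ∂P := by
  have hN := martingale_expDensity hX hXc hg hV hc hgc hgb hVb hMg
  have hNΦ := martingale_expDensity_mul_sub_timeIntegral hX hXc hg hV hf hψ₂ hψ' hc hgc hgb hVb hfb hψ₂b
    hψ'b hMg hMgf hrel
  -- `Φ_r` is `𝓕_r`-measurable and bounded by `Cf + Cψ' r`
  have hψ'X : IsStronglyProgressive 𝓕 fun t ω ↦ ψ' (X t ω) := IsStronglyProgressive.continuous_comp hX hψ'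
  have hΦm : ∀ r, Measurable[𝓕 r] fun ω ↦ f (X r ω) - timeIntegral (fun s ω ↦ ψ' (X s ω)) r ω := fun r ↦
    ((hf.comp_stronglyMeasurable (hX.stronglyAdapted r)).measurable).sub
      (adapted_timeIntegral hψ'X r)
  have hΦb : ∀ r ω, |f (X r ω) - timeIntegral (fun s ω ↦ ψ' (X s ω)) r ω| ≤ Cf + Cψ' * r := fun r ω ↦
    (abs_sub _ _).trans (add_le_add (hfb _) (abs_timeIntegral_le (fun s ω ↦ hψ'b _) r ω))
  rw [setIntegral_mul_eq_of_martingale hN hst htT hA (hΦm t) (hΦb t),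
    setIntegral_mul_eq_of_martingale hN le_rfl (hst.trans htT) hA (hΦm s) (hΦb s)]
  exact (hNΦ.setIntegral_eq hst hA).symm

/-- **The tilted martingale problem under the tilted measure** `Q_T = N_T · P`: for `s ≤ t ≤ T`
and `A ∈ 𝓕_s`, `∫_A Φ_t dQ_T = ∫_A Φ_s dQ_T`, `Φ_r = f(X_r) - ∫₀ʳ ψ'(X_u) du`.
[cite: PalmowskiRolski2002, Thm 4.2] -/
theorem setIntegral_withDensity_expDensity_eq (hX : IsStronglyProgressive 𝓕 X)
    (hXc : ∀ ω, Continuous (X · ω)) {g V f ψ₂ ψ' : ℝ → ℝ} {c Cg CV Cf Cψ₂ Cψ' : ℝ}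
    (hg : Continuous g) (hV : Continuous V) (hf : Continuous f) (hψ₂ : Continuous ψ₂) (hψ' : Continuous ψ')
    (hc : 0 < c) (hgc : ∀ x, c ≤ g x) (hgb : ∀ x, |g x| ≤ Cg) (hVb : ∀ x, |V x| ≤ CV)
    (hfb : ∀ x, |f x| ≤ Cf) (hψ₂b : ∀ x, |ψ₂ x| ≤ Cψ₂) (hψ'b : ∀ x, |ψ' x| ≤ Cψ')
    (hMg : Martingale (fun t ω ↦ g (X t ω) - g (X 0 ω) - timeIntegral (fun s ω ↦ V (X s ω) * g (X s ω)) t ω) 𝓕 P)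
    (hMgf : Martingale (fun t ω ↦ g (X t ω) * f (X t ω) - g (X 0 ω) * f (X 0 ω) -
      timeIntegral (fun s ω ↦ ψ₂ (X s ω)) t ω) 𝓕 P)
    (hrel : ∀ x, ψ₂ x - V x * (g x * f x) = g x * ψ' x)
    {s t T : ℝ≥0} (hst : s ≤ t) (htT : t ≤ T) {A : Set Ω} (hA : MeasurableSet[𝓕 s] A) :
    ∫ ω in A, (f (X t ω) - timeIntegral (fun s ω ↦ ψ' (X s ω)) t ω)
        ∂(P.withDensity fun ω ↦
          ENNReal.ofReal (g (X T ω) / g (X 0 ω) * Real.exp (-timeIntegral (fun s ω ↦ V (X s ω)) T ω))) =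
      ∫ ω in A, (f (X s ω) - timeIntegral (fun s ω ↦ ψ' (X s ω)) s ω)
        ∂(P.withDensity fun ω ↦
          ENNReal.ofReal (g (X T ω) / g (X 0 ω) * Real.exp (-timeIntegral (fun s ω ↦ V (X s ω)) T ω))) := by
  have hN := martingale_expDensity hX hXc hg hV hc hgc hgb hVb hMg
  have hNm : Measurable fun ω ↦ g (X T ω) / g (X 0 ω) * Real.exp (-timeIntegral (fun s ω ↦ V (X s ω)) T ω) :=
    ((hN.stronglyMeasurable T).mono (𝓕.le T)).measurable
  have hAm : MeasurableSet A := 𝓕.le s A hA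
  have key := setIntegral_expDensity_mul_eq hX hXc hg hV hf hψ₂ hψ' hc hgc hgb hVb hfb hψ₂b hψ'b hMg hMgf
    hrel hst htT hA
  -- `ofReal N = ↑(N⁺)` and `N⁺ • Φ = N Φ` since `N > 0`
  have hdens : (fun ω ↦ ENNReal.ofReal (g (X T ω) / g (X 0 ω) *
      Real.exp (-timeIntegral (fun s ω ↦ V (X s ω)) T ω))) = fun ω ↦
      (((g (X T ω) / g (X 0 ω) * Real.exp (-timeIntegral (fun s ω ↦ V (X s ω)) T ω)).toNNReal : ℝ≥0) :
        ℝ≥0∞) := rfl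
  rw [hdens, setIntegral_withDensity_eq_setIntegral_smul hNm.real_toNNReal _ hAm,
    setIntegral_withDensity_eq_setIntegral_smul hNm.real_toNNReal _ hAm]
  simp only [NNReal.smul_def, smul_eq_mul]
  have hpos : ∀ ω, 0 ≤ g (X T ω) / g (X 0 ω) * Real.exp (-timeIntegral (fun s ω ↦ V (X s ω)) T ω) :=
    fun ω ↦ (expDensity_pos hc hgc T ω).le
  simp only [Real.coe_toNNReal _ (hpos _)]
  exact key

end Tilting

end Literature.Probability.Process
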